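import Summits.BirchSwinnertonDyer.Rank1Residual.GaloisImage.AbelianExtensionTorsion
import Literature.NumberTheory.EllipticCurves.IwasawaTwistModP
import HarnessLib

/-!
# (F1) of the `μ`-transfer core on the genuine twist: `𝒯_J(E)^{Gal(ℚ̄/F)} = 0` for every ABELIAN `F/ℚ`
# (`stub_coreX9`, crux 19276 `MuTransferX9`)

Cell `b2b-bsdres` (X9 prover lineage, GEN 44) serving the K6 route `SmallImageMuTransfer` of cell
`bsd-smallim`. HONEST FRAMING: the cell deletes COMBINATION-SHAPED residual classes of the rank-≤1
BSD formula from PUBLISHED theorems only and TYPES the construction-shaped remainder; this is not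
"finishing BSD"; class X9 stays TYPED at class level. `--supports` helper toward `stub_coreX9` of
stmt-BirchSwinnertonDyer-19276; books nothing, closes nothing; theorems only (no definition, no
named fact).

MU-TRANSFER-PROOF (F1): "`E(F)[p] = 0` for every ABELIAN `F/ℚ`; `(𝒯/T^J)^{G_F} = 0`" — used for the
inflation–restriction step of Lemma 2 (`(𝒯_J)^H = 0`, `H = G_K`, `K = ℚ(μ_q)`), for the torsion-freeness
of `𝐇¹_Ω` (F4) and for `H⁰(G_S, ·) = 0` in STEP 1.  The first clause is the tree's
`geomTorsion_eq_zero_of_fixed_of_commutator_le` (`p` odd, `E[p]` irreducible, `U ≤ Γ_ℚ` containing the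
commutator subgroup).  This file lifts it to the genuine twist `𝒯_J(E, κ) = W.modPTwist p κ J`
(k6-ty `IwasawaTwistModP`) by the `T`-adic filtration:

* §1 (generic: any field `K`, any discrete `ρ` on `M` with `p·M = 0`, any `ℤ_p`-extension `κ`, any
  subgroup `U ≤ Γ_K` WITHOUT non-zero fixed vector on `M`): **`twistModP_eq_zero_of_forall_apply_eq`** —
  `U` has no non-zero fixed vector on `𝒯_J(ρ, κ)` for every `J` (induction on `J`: the truncation
  `𝒯_{J+1} → 𝒯_J` is equivariant, and a fixed vector supported in the top coordinate `T^J·m` has `m`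
  fixed, `unipotentPow_single_top`).
* §2 (ℚ, `p` odd, `E[p]` irreducible): **`modPTwist_eq_zero_of_forall_apply_eq_of_commutator_le`** —
  for `U ⊇ [Γ_ℚ, Γ_ℚ]` (i.e. `U = Gal(ℚ̄/F)`, `F ⊆ ℚ^{ab}`: `ℚ(μ_q)`, `ℚ_n`, `ℚ_∞`, their composita) and
  ANY `κ` (so also the dual twist `κ⁻¹ = κ.invTwist`), a `U`-fixed `x ∈ 𝒯_J(E, κ)` is `0`; the forms
  for `U = Γ_ℚ`, `U = Gal(ℚ̄/ℚ_n) = κ.layerSubgroup n` and `U = Gal(ℚ̄/ℚ_∞) = κ'.kerSubgroup`.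

PARTITION (D-0054): X9 (A4) · X10∧¬Surj (A5) at `p = 3` — hypothesis-discharging helper toward
`stub_coreX9`; closes NONE.

References: J.-P. Serre, Invent. Math. 15 (1972) §5.2 (iv), §5.4 [Serre1972]; L. Washington,
*Cyclotomic Fields*, §13.1–§13.2 [Washington1997]; HOME/koly/MU-TRANSFER-PROOF.md (F1).
-/

-- the summit and its single problem are both named `BirchSwinnertonDyer` (registry layout D-0017)
set_option linter.dupNamespace false

set_option autoImplicit false

noncomputable section

open Field WeierstrassCurve Literature.NumberTheory.EllipticCurves
  Literature.NumberTheory.GaloisRepresentations Function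

universe u

namespace Summit.BirchSwinnertonDyer.BirchSwinnertonDyer.Rank1Residual.TwistFixed

/-! ### §1 Generic: no fixed vector on `M` ⟹ no fixed vector on `𝒯_J(ρ, κ)` -/

section Generic

variable {K : Type u} [Field K] {p : ℕ} [Fact p.Prime] (κ : ZpExtension K p)
  {M : Type u} [AddCommGroup M] [TopologicalSpace M] [DiscreteTopology M]
  (ρ : DiscreteGaloisModule K M) (hM : ∀ x : M, p • x = 0)

/-- **No fixed vector on `M` ⟹ no fixed vector on the twist `𝒯_J(ρ, κ) = M ⊗ 𝔽_p[T]/(T^J)(χ_κ)`.**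
If a subgroup `U ≤ Γ_K` fixes no non-zero vector of `M`, it fixes no non-zero vector of `𝒯_J` for
any `J`: by induction on `J` along the equivariant truncation `𝒯_{J+1} → 𝒯_J` (`x ↦ x mod T^J`), a
fixed `x` is supported in the top coordinate, `x = m·T^J`, on which `g` acts by `ρ(g)`
(`unipotentPow_single_top`), so `m` is fixed.  MU-TRANSFER-PROOF (F1), `T`-adic filtration.
[cite: Washington1997, §13.1–§13.2] -/
theorem twistModP_eq_zero_of_forall_apply_eq (U : Subgroup (absoluteGaloisGroup K))
    (hU : ∀ m : M, (∀ σ ∈ U, ρ σ m = m) → m = 0) :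
    ∀ (J : ℕ) (x : Fin J → M), (∀ σ ∈ U, κ.twistModP ρ hM J σ x = x) → x = 0 := by
  intro J
  induction J with
  | zero => intro x _; exact funext fun i => Fin.elim0 i
  | succ J ih =>
    intro x hx
    -- the truncation `x mod T^J` is fixed, hence `0`
    have hy : (fun i : Fin J => x (Fin.castLE (Nat.le_succ J) i)) = 0 := by
      refine ih _ fun σ hσ => ?_
      have h : (fun i : Fin J => κ.twistModP ρ hM (J + 1) σ x (Fin.castLE (Nat.le_succ J) i)) =
          fun i => x (Fin.castLE (Nat.le_succ J) i) := by rw [hx σ hσ]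
      rw [ZpExtension.twistModP_apply, ZpExtension.unipotentPow_comp_castLE,
        ZpExtension.unipotentPow_twistExponent_of_le κ (J + 1) hM (Nat.le_succ J)] at h
      rw [ZpExtension.twistModP_apply]
      exact h
    have hlow : ∀ i : Fin (J + 1), (i : ℕ) < J → x i = 0 := fun i hi => congrFun hy ⟨i, hi⟩
    -- so `x` is supported in the top coordinate
    have hJ1 : 0 < J + 1 := Nat.succ_pos J
    set m : M := x ⟨J + 1 - 1, Nat.sub_lt hJ1 Nat.one_pos⟩ with hm
    have hxs : x = Pi.single (⟨J + 1 - 1, Nat.sub_lt hJ1 Nat.one_pos⟩ : Fin (J + 1)) m := by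
      funext i
      by_cases hi : i = ⟨J + 1 - 1, Nat.sub_lt hJ1 Nat.one_pos⟩
      · rw [hi, Pi.single_eq_same]
      · rw [Pi.single_eq_of_ne hi]
        refine hlow i ?_
        have h1 := i.isLt
        have h2 : (i : ℕ) ≠ J := fun h => hi (Fin.ext (by simp [h]))
        omega
    -- and its top coefficient is fixed on `M`
    have hfix : ∀ σ ∈ U, ρ σ m = m := by
      intro σ hσ
      have h := hx σ hσ
      rw [hxs, ZpExtension.twistModP_apply] at h
      have hmap : (fun i => ρ σ ((Pi.single (⟨J + 1 - 1, Nat.sub_lt hJ1 Nat.one_pos⟩ : Fin (J + 1))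
          m : Fin (J + 1) → M) i)) =
          (Pi.single (⟨J + 1 - 1, Nat.sub_lt hJ1 Nat.one_pos⟩ : Fin (J + 1)) (ρ σ m) :
            Fin (J + 1) → M) := by
        funext i
        by_cases hi : i = ⟨J + 1 - 1, Nat.sub_lt hJ1 Nat.one_pos⟩
        · rw [hi, Pi.single_eq_same, Pi.single_eq_same]
        · rw [Pi.single_eq_of_ne hi, Pi.single_eq_of_ne hi, map_zero]
      rw [hmap, ZpExtension.unipotentPow_single_top hJ1] at h
      have := congrFun h ⟨J + 1 - 1, Nat.sub_lt hJ1 Nat.one_pos⟩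
      rwa [Pi.single_eq_same, Pi.single_eq_same] at this
    rw [hxs, hU m hfix, Pi.single_zero]

/-- Set form: the fixed-point set of `U` on `𝒯_J(ρ, κ)` is `{0}` when it is `{0}` on `M`.
[cite: Washington1997, §13.1–§13.2] -/
theorem forall_twistModP_apply_eq_iff_eq_zero (U : Subgroup (absoluteGaloisGroup K))
    (hU : ∀ m : M, (∀ σ ∈ U, ρ σ m = m) → m = 0) (J : ℕ) (x : Fin J → M) :
    (∀ σ ∈ U, κ.twistModP ρ hM J σ x = x) ↔ x = 0 := by
  refine ⟨twistModP_eq_zero_of_forall_apply_eq κ ρ hM U hU J x, ?_⟩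
  rintro rfl σ -
  exact map_zero _

end Generic

/-! ### §2 Over `ℚ`: `𝒯_J(E, κ)^U = 0` for `U ⊇ [Γ_ℚ, Γ_ℚ]` (`p` odd, `E[p]` irreducible) -/

section Rat

variable (W : WeierstrassCurve ℚ) [W.IsElliptic] (p : ℕ) [Fact p.Prime] (κ : ZpExtension ℚ p)

/-- **MU-TRANSFER-PROOF (F1) on the genuine twist: `𝒯_J(E, κ)^{Gal(ℚ̄/F)} = 0` for `F ⊆ ℚ^{ab}`.**
For `p` odd, `E[p]` irreducible, any `ℤ_p`-extension `κ` of `ℚ` (so also the dual twist `κ⁻¹`), any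
`J`, and any subgroup `U ≤ Γ_ℚ` containing the commutator subgroup, a vector of
`𝒯_J(E, κ) = W.modPTwist p κ J` fixed by `U` is `0` (`E(F)[p] = 0`:
`geomTorsion_eq_zero_of_fixed_of_commutator_le`, lifted by §1). [cite: Serre1972, §5.2 (iv) and §5.4]
[cite: Washington1997, §13.1–§13.2] -/
theorem modPTwist_eq_zero_of_forall_apply_eq_of_commutator_le (hp2 : p ≠ 2)
    (hirr : W.HasIrreducibleModPGaloisRep p) {U : Subgroup (absoluteGaloisGroup ℚ)}
    (hU : commutator (absoluteGaloisGroup ℚ) ≤ U) {J : ℕ} (x : Fin J → geomTorsion W (p : ℤ))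
    (hx : ∀ σ ∈ U, W.modPTwist p κ J σ x = x) : x = 0 :=
  twistModP_eq_zero_of_forall_apply_eq κ (W.torsionGaloisModule (p : ℤ))
    (fun P => AddSubgroup.torsionBy.nsmul P) U
    (fun m hm => Summit.BirchSwinnertonDyer.Rank1Residual.GaloisImage.geomTorsion_eq_zero_of_fixed_of_commutator_le
      W p hp2 hirr hU m fun σ hσ => by rw [← torsionGaloisModule_apply_apply]; exact hm σ hσ)
    J x hx

/-- `𝒯_J(E, κ)^{Γ_ℚ} = 0` (`U = ⊤`; `H⁰(ℚ, 𝒯_J) = 0` of (F1)/(F4)). [cite: Serre1972, §5.2 (iv) and §5.4]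
[cite: Washington1997, §13.1–§13.2] -/
theorem modPTwist_eq_zero_of_forall_apply_eq (hp2 : p ≠ 2) (hirr : W.HasIrreducibleModPGaloisRep p)
    {J : ℕ} (x : Fin J → geomTorsion W (p : ℤ))
    (hx : ∀ σ : absoluteGaloisGroup ℚ, W.modPTwist p κ J σ x = x) : x = 0 :=
  modPTwist_eq_zero_of_forall_apply_eq_of_commutator_le W p κ hp2 hirr (U := ⊤) le_top x
    fun σ _ => hx σ

/-- `𝒯_J(E, κ)^{Gal(ℚ̄/F_n)} = 0` for the layers `F_n` of ANY `ℤ_p`-extension `κ'` of `ℚ` (abelian over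
`ℚ`): `U = κ'.layerSubgroup n`. With `κ' = κ` cyclotomic: "`G_{ℚ_n}` has no fixed vector on `𝒯_J`".
[cite: Serre1972, §5.2 (iv) and §5.4] [cite: Washington1997, §13.1–§13.2] -/
theorem modPTwist_eq_zero_of_forall_mem_layerSubgroup_apply_eq (hp2 : p ≠ 2)
    (hirr : W.HasIrreducibleModPGaloisRep p) (κ' : ZpExtension ℚ p) (n : ℕ) {J : ℕ}
    (x : Fin J → geomTorsion W (p : ℤ))
    (hx : ∀ σ ∈ κ'.layerSubgroup n, W.modPTwist p κ J σ x = x) : x = 0 :=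
  modPTwist_eq_zero_of_forall_apply_eq_of_commutator_le W p κ hp2 hirr
    ((Abelianization.commutator_subset_ker κ'.toContinuousMonoidHom.toMonoidHom).trans
      (κ'.kerSubgroup_le_layerSubgroup n)) x hx

/-- `𝒯_J(E, κ)^{Gal(ℚ̄/F_∞)} = 0` for the top field `F_∞` of ANY `ℤ_p`-extension `κ'` of `ℚ`:
`U = κ'.kerSubgroup` (MU-TRANSFER-PROOF (F1): "invariants under `G_{Fℚ_∞}` already vanish").
[cite: Serre1972, §5.2 (iv) and §5.4] [cite: Washington1997, §13.1–§13.2] -/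
theorem modPTwist_eq_zero_of_forall_mem_kerSubgroup_apply_eq (hp2 : p ≠ 2)
    (hirr : W.HasIrreducibleModPGaloisRep p) (κ' : ZpExtension ℚ p) {J : ℕ}
    (x : Fin J → geomTorsion W (p : ℤ))
    (hx : ∀ σ ∈ κ'.kerSubgroup, W.modPTwist p κ J σ x = x) : x = 0 :=
  modPTwist_eq_zero_of_forall_apply_eq_of_commutator_le W p κ hp2 hirr
    (Abelianization.commutator_subset_ker κ'.toContinuousMonoidHom.toMonoidHom) x hx

/-- The `TopRep` spelling used by the cocycle lemmas (`X.ρ τ x = x`): for `U ⊇ [Γ_ℚ, Γ_ℚ]`, the only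
`U`-fixed vector of `(W.modPTwist p κ J).toTopRep` is `0`. [cite: Serre1972, §5.2 (iv) and §5.4]
[cite: Washington1997, §13.1–§13.2] -/
theorem toTopRep_eq_zero_of_forall_ρ_apply_eq_of_commutator_le (hp2 : p ≠ 2)
    (hirr : W.HasIrreducibleModPGaloisRep p) {U : Subgroup (absoluteGaloisGroup ℚ)}
    (hU : commutator (absoluteGaloisGroup ℚ) ≤ U) {J : ℕ} (x : (W.modPTwist p κ J).toTopRep)
    (hx : ∀ σ ∈ U, (W.modPTwist p κ J).toTopRep.ρ σ x = x) : x = 0 :=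
  modPTwist_eq_zero_of_forall_apply_eq_of_commutator_le W p κ hp2 hirr hU x hx

end Rat

end Summit.BirchSwinnertonDyer.BirchSwinnertonDyer.Rank1Residual.TwistFixed

end
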